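/-
Copyright (c) 2026 the pub-hodgecm-mathlib formalisation cell (harness21).  Prover seat hodgecm-mathlib-F0P3a-p08 (g20): road «S3-ram» (LEAD F0P3a-plan (g13);
owner F0P3a-p06), (T2) G-side organ (Cnt2′), chair heir F0P3a-p07 (g15) RULING (13) (6): `stub_Zhyp` composition pen; part (z7-a) «THE ROUTE-B RAW HEADS AT A CENTRED
HYPERBOLIC BLOCK LITERAL `ι(B₀, 1)`, LATTICE SLOTS DISCHARGED» (over (h1) A-p19 (g29) `UnitaryLatticeTreeFrameLiteralCentring`); 2026-09-02.
-/
import Literature.NumberTheory.Rogawski1990.DepthZeroKappaTransferTypeOneRamifiedJunctionStrataCountBlockEvenOfCharpoly   -- ★ p848995 (F0P3-p03 (g16)): `strataCount_J₀_of_charpoly_block_even`; brings ★ p848814 (F0P2-p02 (g14)): `strataCount_J₀_of_charpoly_block_raw`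
import Literature.NumberTheory.Automorphic.UnitaryLatticeTreeFrameLiteralCentring                                        -- (h1) A-p19 (g29): `endoGL_one_mem_unitaryInt`, `charpoly_coe_endoGL_one`, `map_sub_one_stdLattice_le_scaleLattice_endoGL_one`, `finite_setOf_latticeGraphIso_endoGL_one_antidiagonal`
import HarnessLib

/-!
# The five strata counts of a CENTRED HYPERBOLIC type-(2) literal `ι(B₀, 1)` in the `Φ₃`-model: the route-B raw heads (odd ∕ even root depth) with their literal slots
# `hγ0`, `lam`, `Bm`, `hchar`, `hlam`, `hBm`, `hroot`, `hFfin` discharged; root region and pooled label counts kept abstract (Kottwitz 1986 §3; Rogawski 1990 §4.9)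

Topic `NumberTheory/Rogawski1990`; namespace `Literature.NumberTheory.Rogawski1990.TypeOneRamifiedJunction`.  THEOREMS ONLY (no definition, no instance, no notation, no named
fact, no `sorry`); kernel lane `--supports stmt-HodgeConjecture-24833`; datum-free generic `K` currency of the route-B heads.  Cell `pub/hodgecm-mathlib` (D-0151), crux H413;
road «S3-ram» (Literature seeding, count-neutral); (T2) G-side organ (Cnt2′); chair heir F0P3a-p07 (g15) RULING (13) (6): this seat is the COMPOSITION PEN of the (α)
keeper's sub-stubs `stub_Zhyp_{row,par,branch}` (the closed totals of the HYPERBOLIC literal).  GLUE ONLY.  After (h1) A-p19 (g29)'s centring ∕ re-rooting, the hyperbolic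
literal is `γ` with `↑γ = ι(B₀, 1) = endoGL (B₀, 1)` (`B₀ = k⁻¹·(s·g)·k`, any `k ∈ U(σ, Φ₂)`), of block depth `d₀`: `|(B₀ − 1) i j| ≤ |ϖ|^{d₀}`.  The route-B raw heads ★
p848814 `strataCount_J₀_of_charpoly_block_raw` (odd `d₀ = 2mA+3`, F0P2-p02 (g14)) ∕ ★ p848995 `strataCount_J₀_of_charpoly_block_even` (even `d₀ = 2mA+2`, F0P3-p03 (g16))
take the literal through the slots `hγ0 lam Bm hchar hlam hBm hroot hFfin`; for `γ = ι(B₀, 1)` ALL of them are (h1)'s heads: `hγ0` = `endoGL_one_mem_unitaryInt`, `lam := 1`,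
`Bm := ↑B₀`, `hchar` = `charpoly_coe_endoGL_one`, `hlam` trivial, `hBm := hd`, `hroot` = `map_sub_one_stdLattice_le_scaleLattice_endoGL_one`, `hFfin` =
`finite_setOf_latticeGraphIso_endoGL_one_antidiagonal` (`B₀` integral from `hd`, `χ_{B₀}` rootless, principal units squares).  THIS FILE is the composite: the raw heads'
statements with those slots replaced by `(B₀) (hγ : ↑γ = endoGL (B₀, 1)) (hd) (hsq) (hirr)`, the root-region binders `sR hsR` and the pooled counts `PE [PO] PP PM hPE [hPO]
hPP hPM` and the conclusions BYTE-IDENTICAL — so the `stub_Zhyp` cells reduce to: `sR.card` (★ p849125 THM 5 `ncard_rootRegion_eq_ncard_two_of_coe_eq_endoGL` ∘ A-p12's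
W-ball count), the pooled counts ((4a) kind-keyed pooling ∘ (4b) per-kind values), (h1)'s end-to-end transports `ncard_{deep,rankOne,rankOneNot}_endoGL_eq_rerooted` back to
`ι(g, u)`, and the CM dictionary.

* **`strataCount_J₀_of_charpoly_block_raw_endoGL_one`** (odd root depth), **`strataCount_J₀_of_charpoly_block_even_endoGL_one`** (even root depth).

HONEST LABEL: HC_CM is proved only modulo the 2 remaining named inputs (hLiu418 24832, h413 24833) until rung 0 closes; nothing printed is asserted here (composition of ★
theorems); «S3-ram» has no books consequence.

## References
* [Kottwitz1986] R. E. Kottwitz, *Base change for unit elements of Hecke algebras*, Compositio Math. 60 (1986), §3.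
* [Rogawski1990] J. D. Rogawski, *Automorphic Representations of Unitary Groups in Three Variables*, Ann. of Math. Stud. 123 (1990), §4.9 pp. 54–56.
* [BruhatTits1972] F. Bruhat, J. Tits, *Groupes réductifs sur un corps local I*, Publ. Math. IHÉS 41 (1972), §10.
-/

set_option autoImplicit false

noncomputable section

open scoped Valued WithZero Matrix MatrixGroups
open Polynomial Classical SimpleGraph
open Literature.Combinatorics.SimpleGraph.TreeLayers
open Literature.NumberTheory.Automorphic Literature.NumberTheory.Automorphic.HermitianLattice Literature.NumberTheory.Automorphic.UnitaryLatticeTree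

namespace Literature.NumberTheory.Rogawski1990.TypeOneRamifiedJunction

variable {K : Type*} [Field K] [Valued K ℤᵐ⁰] {σ : K →+* K} {ϖ : K}

set_option maxHeartbeats 1600000 in
-- budget only: statement-heavy lattice tokens (verbatim the ★ raw head's budget).
/-- **THE FIVE STRATA COUNTS OF THE CENTRED HYPERBOLIC LITERAL `ι(B₀, 1)`, ODD ROOT DEPTH** — ★ `strataCount_J₀_of_charpoly_block_raw` (F0P2-p02 (g14)) with the literal
slots `hγ0 lam Bm hchar hlam hBm hroot hFfin` discharged by (h1) A-p19 (g29)'s heads at `↑γ = endoGL (B₀, 1)` (`hd` the block depth, `hsq`, `hirr`); root region `sR hsR`,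
pooled label counts `PE PP PM hPE hPP hPM` and the conclusion `sR.card • e₄ + PE • T(E_{mA+1}) + PP • T(P⁺_{mA}) + PM • T(P⁻_{mA})` VERBATIM.
[cite: Kottwitz1986, §3] [cite: Rogawski1990, §4.9 pp. 54–56] [cite: BruhatTits1972, §10] -/
theorem strataCount_J₀_of_charpoly_block_raw_endoGL_one [ValuativeRel K] [(Valued.v : Valuation K ℤᵐ⁰).Compatible]
    (hσ : ∀ x, σ (σ x) = x) (hvσ : ∀ a, Valued.v (σ a) = Valued.v a) (hσϖ : σ ϖ = -ϖ)
    (hϖ : Valued.v ϖ = WithZero.exp (-1 : ℤ)) (hres : ∀ x : K, Valued.v x ≤ 1 → Valued.v (σ x - x) < 1) (h2 : Valued.v (2 : K) = 1)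
    (hnorm : ∀ u : K, σ u = u → Valued.v (u - 1) < 1 → ∃ z : K, z * σ z = u ∧ Valued.v (z - 1) ≤ Valued.v (u - 1)) [Fintype 𝓀[K]] [DecidableEq 𝓀[K]]
    {γ : unitaryGroupOfForm σ ((StdForm.antidiagonal 3).over K)} (B₀ : GL (Fin 2) K)
    (hγ : (γ : GL (Fin 3) K) = endoGL (B₀, (1 : GL (Fin 1) K)))
    {d₀ : ℕ} (hd : ∀ i j, Valued.v (((B₀ : Matrix (Fin 2) (Fin 2) K) - 1) i j) ≤ Valued.v ϖ ^ d₀)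
    (hsq : ∀ t : K, Valued.v (t - 1) < 1 → IsSquare t) (hirr : ∀ x : K, ¬ (B₀ : Matrix (Fin 2) (Fin 2) K).charpoly.IsRoot x)
    (mA : ℕ) (hmA : d₀ = 2 * mA + 3)
    (c₁ ε : K) (hc₁ : Valued.v c₁ = 1) (hεv : Valued.v ε = 1) (hε : ∀ z : K, Valued.v z ≤ 1 → Valued.v (z ^ 2 - ε) = 1)
    (q : ℕ) (hq : q = Fintype.card 𝓀[K])
    (sR : Finset {M : Submodule 𝒪[K] (Fin 3 → K) // IsVertex σ ϖ ((StdForm.antidiagonal 3).over K) M}) (hsR : ∀ v, v ∈ sR ↔ v ∈ {v : {M : Submodule 𝒪[K] (Fin 3 → K) // IsVertex σ ϖ ((StdForm.antidiagonal 3).over K) M} | latticeGraphIso σ ϖ ((StdForm.antidiagonal 3).over K) γ v = v ∧ IsSelfDualLattice σ ϖ ((StdForm.antidiagonal 3).over K) v.1 ∧ v.1.map ((Matrix.toLin' (((γ : GL (Fin 3) K) : Matrix (Fin 3) (Fin 3) K) - 1)).restrictScalars 𝒪[K]) ≤ scaleLattice (ϖ ^ d₀) v.1})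
    (PE PP PM : ℕ)
    (hPE : ∑ v ∈ sR, ({w | w ∈ {w | ∃ c, ((latticeGraph σ ϖ ((StdForm.antidiagonal 3).over K)).Adj v c ∧ (latticeGraph σ ϖ ((StdForm.antidiagonal 3).over K)).dist ⟨stdLattice K 3, 0, isSelfDualLattice_stdLattice_three_of_v hϖ⟩ c = (latticeGraph σ ϖ ((StdForm.antidiagonal 3).over K)).dist ⟨stdLattice K 3, 0, isSelfDualLattice_stdLattice_three_of_v hϖ⟩ v + 1 ∧ latticeGraphIso σ ϖ ((StdForm.antidiagonal 3).over K) γ c = c) ∧ ((latticeGraph σ ϖ ((StdForm.antidiagonal 3).over K)).Adj c w ∧ (latticeGraph σ ϖ ((StdForm.antidiagonal 3).over K)).dist ⟨stdLattice K 3, 0, isSelfDualLattice_stdLattice_three_of_v hϖ⟩ w = (latticeGraph σ ϖ ((StdForm.antidiagonal 3).over K)).dist ⟨stdLattice K 3, 0, isSelfDualLattice_stdLattice_three_of_v hϖ⟩ c + 1 ∧ latticeGraphIso σ ϖ ((StdForm.antidiagonal 3).over K) γ w = w)} ∧ (¬ w.1.map ((Matrix.toLin' (((γ : GL (Fin 3)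 K) : Matrix (Fin 3) (Fin 3) K) - 1)).restrictScalars 𝒪[K]) ≤ scaleLattice (ϖ ^ d₀) w.1 ∧ (w.1.map ((Matrix.toLin' (((γ : GL (Fin 3) K) : Matrix (Fin 3) (Fin 3) K) - 1)).restrictScalars 𝒪[K]) ≤ scaleLattice (ϖ ^ (d₀ - 1)) w.1 ∧ ¬ w.1.map ((Matrix.toLin' (((γ : GL (Fin 3) K) : Matrix (Fin 3) (Fin 3) K) - 1)).restrictScalars 𝒪[K]) ≤ scaleLattice (ϖ ^ d₀) w.1))}).ncard = PE)
    (hPP : ∑ v ∈ sR, ({w | w ∈ {w | ∃ c, ((latticeGraph σ ϖ ((StdForm.antidiagonal 3).over K)).Adj v c ∧ (latticeGraph σ ϖ ((StdForm.antidiagonal 3).over K)).dist ⟨stdLattice K 3, 0, isSelfDualLattice_stdLattice_three_of_v hϖ⟩ c = (latticeGraph σ ϖ ((StdForm.antidiagonal 3).over K)).dist ⟨stdLattice K 3, 0, isSelfDualLattice_stdLattice_three_of_v hϖ⟩ v + 1 ∧ latticeGraphIso σ ϖ ((StdForm.antidiagonal 3).over K) γ c = c) ∧ ((latticeGraph σ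 ϖ ((StdForm.antidiagonal 3).over K)).Adj c w ∧ (latticeGraph σ ϖ ((StdForm.antidiagonal 3).over K)).dist ⟨stdLattice K 3, 0, isSelfDualLattice_stdLattice_three_of_v hϖ⟩ w = (latticeGraph σ ϖ ((StdForm.antidiagonal 3).over K)).dist ⟨stdLattice K 3, 0, isSelfDualLattice_stdLattice_three_of_v hϖ⟩ c + 1 ∧ latticeGraphIso σ ϖ ((StdForm.antidiagonal 3).over K) γ w = w)} ∧ (¬ w.1.map ((Matrix.toLin' (((γ : GL (Fin 3) K) : Matrix (Fin 3) (Fin 3) K) - 1)).restrictScalars 𝒪[K]) ≤ scaleLattice (ϖ ^ d₀) w.1 ∧ (w.1.map ((Matrix.toLin' (((γ : GL (Fin 3) K) : Matrix (Fin 3) (Fin 3) K) - 1)).restrictScalars 𝒪[K]) ≤ scaleLattice (ϖ ^ (d₀ - 2)) w.1 ∧ ¬ w.1.map ((Matrix.toLin' (((γ : GL (Fin 3) K) : Matrix (Fin 3) (Fin 3) K) - 1)).restrictScalars 𝒪[K]) ≤ scaleLattice (ϖ ^ (d₀ - 1)) w.1) ∧ ∃ y ∈ w.1, ∃ a : K,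 Valued.v a = 1 ∧ Valued.v ((ϖ ^ (d₀ - 2))⁻¹ * pairing σ ((StdForm.antidiagonal 3).over K) y ((((γ : GL (Fin 3) K) : Matrix (Fin 3) (Fin 3) K) - 1) *ᵥ y) - (c₁) * a ^ 2) < 1)}).ncard = PP)
    (hPM : ∑ v ∈ sR, ({w | w ∈ {w | ∃ c, ((latticeGraph σ ϖ ((StdForm.antidiagonal 3).over K)).Adj v c ∧ (latticeGraph σ ϖ ((StdForm.antidiagonal 3).over K)).dist ⟨stdLattice K 3, 0, isSelfDualLattice_stdLattice_three_of_v hϖ⟩ c = (latticeGraph σ ϖ ((StdForm.antidiagonal 3).over K)).dist ⟨stdLattice K 3, 0, isSelfDualLattice_stdLattice_three_of_v hϖ⟩ v + 1 ∧ latticeGraphIso σ ϖ ((StdForm.antidiagonal 3).over K) γ c = c) ∧ ((latticeGraph σ ϖ ((StdForm.antidiagonal 3).over K)).Adj c w ∧ (latticeGraph σ ϖ ((StdForm.antidiagonal 3).over K)).dist ⟨stdLattice K 3, 0, isSelfDualLattice_stdLattice_three_of_v hϖ⟩ w = (latticeGraph σ ϖ ((StdForm.antidiagonal 3).over K)).dist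 ⟨stdLattice K 3, 0, isSelfDualLattice_stdLattice_three_of_v hϖ⟩ c + 1 ∧ latticeGraphIso σ ϖ ((StdForm.antidiagonal 3).over K) γ w = w)} ∧ (¬ w.1.map ((Matrix.toLin' (((γ : GL (Fin 3) K) : Matrix (Fin 3) (Fin 3) K) - 1)).restrictScalars 𝒪[K]) ≤ scaleLattice (ϖ ^ d₀) w.1 ∧ (w.1.map ((Matrix.toLin' (((γ : GL (Fin 3) K) : Matrix (Fin 3) (Fin 3) K) - 1)).restrictScalars 𝒪[K]) ≤ scaleLattice (ϖ ^ (d₀ - 2)) w.1 ∧ ¬ w.1.map ((Matrix.toLin' (((γ : GL (Fin 3) K) : Matrix (Fin 3) (Fin 3) K) - 1)).restrictScalars 𝒪[K]) ≤ scaleLattice (ϖ ^ (d₀ - 1)) w.1) ∧ ¬ (∃ y ∈ w.1, ∃ a : K, Valued.v a = 1 ∧ Valued.v ((ϖ ^ (d₀ - 2))⁻¹ * pairing σ ((StdForm.antidiagonal 3).over K) y ((((γ : GL (Fin 3) K) : Matrix (Fin 3) (Fin 3) K) - 1) *ᵥ y) - (c₁) * a ^ 2) < 1))}).ncard = PM)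 (j : Fin 5) :
    ({M : Submodule 𝒪[K] (Fin 3 → K) | IsSelfDualLattice σ ϖ ((StdForm.antidiagonal 3).over K) M ∧ mapGL (γ : GL (Fin 3) K) M = M ∧
        (![¬ M.map ((Matrix.toLin' (((γ : GL (Fin 3) K) : Matrix (Fin 3) (Fin 3) K) - 1)).restrictScalars 𝒪[K]) ≤ scaleLattice ϖ M,
                  M.map ((Matrix.toLin' (((γ : GL (Fin 3) K) : Matrix (Fin 3) (Fin 3) K) - 1)).restrictScalars 𝒪[K]) ≤ scaleLattice ϖ M ∧
                    ¬ M.map ((Matrix.toLin' (((γ : GL (Fin 3) K) : Matrix (Fin 3) (Fin 3) K) - 1)).restrictScalars 𝒪[K]) ≤ scaleLattice (ϖ ^ 2) M ∧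
                    ¬ M.map ((Matrix.toLin' ((((γ : GL (Fin 3) K) : Matrix (Fin 3) (Fin 3) K) - 1) ^ 2)).restrictScalars 𝒪[K]) ≤ scaleLattice (ϖ ^ 3) M,
                  M.map ((Matrix.toLin' (((γ : GL (Fin 3) K) : Matrix (Fin 3) (Fin 3) K) - 1)).restrictScalars 𝒪[K]) ≤ scaleLattice ϖ M ∧
                    ¬ M.map ((Matrix.toLin' (((γ : GL (Fin 3) K) : Matrix (Fin 3) (Fin 3) K) - 1)).restrictScalars 𝒪[K]) ≤ scaleLattice (ϖ ^ 2) M ∧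
                    M.map ((Matrix.toLin' ((((γ : GL (Fin 3) K) : Matrix (Fin 3) (Fin 3) K) - 1) ^ 2)).restrictScalars 𝒪[K]) ≤ scaleLattice (ϖ ^ 3) M ∧
                    ∃ y ∈ M, ∃ a : K, Valued.v a = 1 ∧
                      Valued.v (ϖ⁻¹ * pairing σ (((StdForm.antidiagonal 3).over K)) y
                        ((((γ : GL (Fin 3) K) : Matrix (Fin 3) (Fin 3) K) - 1) *ᵥ y) - c₁ * a ^ 2) < 1,
                  M.map ((Matrix.toLin' (((γ : GL (Fin 3) K) : Matrix (Fin 3) (Fin 3) K) - 1)).restrictScalars 𝒪[K]) ≤ scaleLattice ϖ M ∧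
                    ¬ M.map ((Matrix.toLin' (((γ : GL (Fin 3) K) : Matrix (Fin 3) (Fin 3) K) - 1)).restrictScalars 𝒪[K]) ≤ scaleLattice (ϖ ^ 2) M ∧
                    M.map ((Matrix.toLin' ((((γ : GL (Fin 3) K) : Matrix (Fin 3) (Fin 3) K) - 1) ^ 2)).restrictScalars 𝒪[K]) ≤ scaleLattice (ϖ ^ 3) M ∧
                    ∃ y ∈ M, ∃ a : K, Valued.v a = 1 ∧
                      Valued.v (ϖ⁻¹ * pairing σ (((StdForm.antidiagonal 3).over K)) y
                        ((((γ : GL (Fin 3) K) : Matrix (Fin 3) (Fin 3) K) - 1) *ᵥ y) - c₁ * ε * a ^ 2) < 1,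
                  M.map ((Matrix.toLin' (((γ : GL (Fin 3) K) : Matrix (Fin 3) (Fin 3) K) - 1)).restrictScalars 𝒪[K]) ≤ scaleLattice (ϖ ^ 2) M] : Fin 5 → Prop) j}.ncard) =
      (if IsSquare (-1 : 𝓀[K]) then
          (sR.card • (![0, 0, 0, 0, 1] : Fin 5 → ℕ) + PE • (![q ^ (3 * mA + 3), q ^ (3 * mA + 2), q.choose 2 * q ^ (2 * mA) * ∑ i ∈ Finset.range mA, q ^ i, q.choose 2 * q ^ (2 * mA) * ∑ i ∈ Finset.range mA, q ^ i,
          ∑ i ∈ Finset.range (mA + 1), q ^ (2 * i) + ∑ i ∈ Finset.range mA, q ^ (2 * mA + 1 + i)] : Fin 5 → ℕ) + PP • (![0, 0, q ^ (2 * mA), 0, ∑ i ∈ Finset.range mA, q ^ (2 * i)] : Fin 5 → ℕ) + PM • (![0, 0, 0, q ^ (2 * mA), ∑ i ∈ Finset.range mA, q ^ (2 * i)] : Fin 5 → ℕ)) j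
        else
          (sR.card • (![0, 0, 0, 0, 1] : Fin 5 → ℕ) + PE • (![q ^ (3 * mA + 3), q ^ (3 * mA + 2), q.choose 2 * q ^ (2 * mA) * ∑ i ∈ Finset.range mA, q ^ i, q.choose 2 * q ^ (2 * mA) * ∑ i ∈ Finset.range mA, q ^ i,
          ∑ i ∈ Finset.range (mA + 1), q ^ (2 * i) + ∑ i ∈ Finset.range mA, q ^ (2 * mA + 1 + i)] : Fin 5 → ℕ) + PP • (![0, 0, if Even mA then q ^ (2 * mA) else 0, if Even mA then 0 else q ^ (2 * mA), ∑ i ∈ Finset.range mA, q ^ (2 * i)] : Fin 5 → ℕ) + PM • (![0, 0, if Even mA then 0 else q ^ (2 * mA), if Even mA then q ^ (2 * mA) else 0, ∑ i ∈ Finset.range mA, q ^ (2 * i)] : Fin 5 → ℕ)) j) := by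
  obtain ⟨γv, hγU⟩ := γ
  change γv = _ at hγ
  subst hγ
  have hϖ0 : ϖ ≠ 0 := fun h0 => by rw [h0, map_zero] at hϖ; exact WithZero.coe_ne_zero hϖ.symm
  have hϖ1 : Valued.v ϖ < 1 := by rw [hϖ, ← WithZero.exp_zero]; exact WithZero.exp_lt_exp.2 (by norm_num)
  have hd1 : 1 ≤ d₀ := by omega
  have hBint : IsIntMatrix (B₀ : Matrix (Fin 2) (Fin 2) K) := fun i j => by
    have hϖd : Valued.v ϖ ^ d₀ ≤ 1 := pow_le_one₀ zero_le hϖ1.le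
    have h1 : Valued.v ((1 : Matrix (Fin 2) (Fin 2) K) i j) ≤ 1 := by
      rcases eq_or_ne i j with rfl | hij
      · rw [Matrix.one_apply_eq, map_one]
      · rw [Matrix.one_apply_ne hij, map_zero]; exact zero_le
    have h := Valuation.map_add_le (Valued.v) ((hd i j).trans hϖd) h1
    rwa [Matrix.sub_apply, sub_add_cancel] at h
  exact strataCount_J₀_of_charpoly_block_raw hσ hvσ hσϖ hϖ hres h2 hnorm (endoGL_one_mem_unitaryInt hϖ1 hγU hd1 hd) 1 (B₀ : Matrix (Fin 2) (Fin 2) K)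
    (charpoly_coe_endoGL_one B₀) (by rw [sub_self, map_zero]; exact zero_le) hd (map_sub_one_stdLattice_le_scaleLattice_endoGL_one hϖ0 hd)
    (finite_setOf_latticeGraphIso_endoGL_one_antidiagonal hvσ h2 hsq hϖ B₀ hBint hirr _ rfl)
    mA hmA c₁ ε hc₁ hεv hε q hq sR hsR PE PP PM hPE hPP hPM j

set_option maxHeartbeats 1600000 in
-- budget only: statement-heavy lattice tokens (verbatim the ★ even head's budget).
/-- **THE FIVE STRATA COUNTS OF THE CENTRED HYPERBOLIC LITERAL `ι(B₀, 1)`, EVEN ROOT DEPTH** — ★ `strataCount_J₀_of_charpoly_block_even` (F0P3-p03 (g16)) with the literal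
slots discharged by (h1)'s heads at `↑γ = endoGL (B₀, 1)`; root region, pooled counts `PE PO PP PM` and conclusion VERBATIM.
[cite: Kottwitz1986, §3] [cite: Rogawski1990, §4.9 pp. 54–56] [cite: BruhatTits1972, §10] -/
theorem strataCount_J₀_of_charpoly_block_even_endoGL_one [ValuativeRel K] [(Valued.v : Valuation K ℤᵐ⁰).Compatible]
    (hσ : ∀ x, σ (σ x) = x) (hvσ : ∀ a, Valued.v (σ a) = Valued.v a) (hσϖ : σ ϖ = -ϖ)
    (hϖ : Valued.v ϖ = WithZero.exp (-1 : ℤ)) (hres : ∀ x : K, Valued.v x ≤ 1 → Valued.v (σ x - x) < 1) (h2 : Valued.v (2 : K) = 1)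
    (hnorm : ∀ u : K, σ u = u → Valued.v (u - 1) < 1 → ∃ z : K, z * σ z = u ∧ Valued.v (z - 1) ≤ Valued.v (u - 1)) [Fintype 𝓀[K]] [DecidableEq 𝓀[K]]
    {γ : unitaryGroupOfForm σ ((StdForm.antidiagonal 3).over K)} (B₀ : GL (Fin 2) K)
    (hγ : (γ : GL (Fin 3) K) = endoGL (B₀, (1 : GL (Fin 1) K)))
    {d₀ : ℕ} (hd : ∀ i j, Valued.v (((B₀ : Matrix (Fin 2) (Fin 2) K) - 1) i j) ≤ Valued.v ϖ ^ d₀)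
    (hsq : ∀ t : K, Valued.v (t - 1) < 1 → IsSquare t) (hirr : ∀ x : K, ¬ (B₀ : Matrix (Fin 2) (Fin 2) K).charpoly.IsRoot x)
    (mA : ℕ) (hmA : d₀ = 2 * mA + 2)
    (c₁ ε : K) (hc₁ : Valued.v c₁ = 1) (hεv : Valued.v ε = 1) (hε : ∀ z : K, Valued.v z ≤ 1 → Valued.v (z ^ 2 - ε) = 1)
    (q : ℕ) (hq : q = Fintype.card 𝓀[K])
    (sR : Finset {M : Submodule 𝒪[K] (Fin 3 → K) // IsVertex σ ϖ ((StdForm.antidiagonal 3).over K) M}) (hsR : ∀ v, v ∈ sR ↔ v ∈ {v : {M : Submodule 𝒪[K] (Fin 3 → K) // IsVertex σ ϖ ((StdForm.antidiagonal 3).over K) M} | latticeGraphIso σ ϖ ((StdForm.antidiagonal 3).over K) γ v = v ∧ IsSelfDualLattice σ ϖ ((StdForm.antidiagonal 3).over K) v.1 ∧ v.1.map ((Matrix.toLin' (((γ : GL (Fin 3) K) : Matrix (Fin 3) (Fin 3) K) - 1)).restrictScalars 𝒪[K]) ≤ scaleLattice (ϖ ^ d₀) v.1})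
    (PE PO PP PM : ℕ)
    (hPE : ∑ v ∈ sR, ({w | w ∈ {w | ∃ c, ((latticeGraph σ ϖ ((StdForm.antidiagonal 3).over K)).Adj v c ∧ (latticeGraph σ ϖ ((StdForm.antidiagonal 3).over K)).dist ⟨stdLattice K 3, 0, isSelfDualLattice_stdLattice_three_of_v hϖ⟩ c = (latticeGraph σ ϖ ((StdForm.antidiagonal 3).over K)).dist ⟨stdLattice K 3, 0, isSelfDualLattice_stdLattice_three_of_v hϖ⟩ v + 1 ∧ latticeGraphIso σ ϖ ((StdForm.antidiagonal 3).over K) γ c = c) ∧ ((latticeGraph σ ϖ ((StdForm.antidiagonal 3).over K)).Adj c w ∧ (latticeGraph σ ϖ ((StdForm.antidiagonal 3).over K)).dist ⟨stdLattice K 3, 0, isSelfDualLattice_stdLattice_three_of_v hϖ⟩ w = (latticeGraph σ ϖ ((StdForm.antidiagonal 3).over K)).dist ⟨stdLattice K 3, 0, isSelfDualLattice_stdLattice_three_of_v hϖ⟩ c + 1 ∧ latticeGraphIso σ ϖ ((StdForm.antidiagonal 3).over K) γ w = w)} ∧ (¬ w.1.map ((Matrix.toLin' (((γ : GL (Fin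 3) K) : Matrix (Fin 3) (Fin 3) K) - 1)).restrictScalars 𝒪[K]) ≤ scaleLattice (ϖ ^ d₀) w.1 ∧ (w.1.map ((Matrix.toLin' (((γ : GL (Fin 3) K) : Matrix (Fin 3) (Fin 3) K) - 1)).restrictScalars 𝒪[K]) ≤ scaleLattice (ϖ ^ (d₀ - 2)) w.1 ∧ ¬ w.1.map ((Matrix.toLin' (((γ : GL (Fin 3) K) : Matrix (Fin 3) (Fin 3) K) - 1)).restrictScalars 𝒪[K]) ≤ scaleLattice (ϖ ^ (d₀ - 1)) w.1))}).ncard = PE)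
    (hPO : ∑ v ∈ sR, ({w | w ∈ {w | ∃ c, ((latticeGraph σ ϖ ((StdForm.antidiagonal 3).over K)).Adj v c ∧ (latticeGraph σ ϖ ((StdForm.antidiagonal 3).over K)).dist ⟨stdLattice K 3, 0, isSelfDualLattice_stdLattice_three_of_v hϖ⟩ c = (latticeGraph σ ϖ ((StdForm.antidiagonal 3).over K)).dist ⟨stdLattice K 3, 0, isSelfDualLattice_stdLattice_three_of_v hϖ⟩ v + 1 ∧ latticeGraphIso σ ϖ ((StdForm.antidiagonal 3).over K) γ c = c) ∧ ((latticeGraph σ ϖ ((StdForm.antidiagonal 3).over K)).Adj c w ∧ (latticeGraph σ ϖ ((StdForm.antidiagonal 3).over K)).dist ⟨stdLattice K 3, 0, isSelfDualLattice_stdLattice_three_of_v hϖ⟩ w = (latticeGraph σ ϖ ((StdForm.antidiagonal 3).over K)).dist ⟨stdLattice K 3, 0, isSelfDualLattice_stdLattice_three_of_v hϖ⟩ c + 1 ∧ latticeGraphIso σ ϖ ((StdForm.antidiagonal 3).over K) γ w = w)} ∧ (¬ w.1.map ((Matrix.toLin' (((γ : GL (Fin 3) K) : Matrix (Fin 3)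 (Fin 3) K) - 1)).restrictScalars 𝒪[K]) ≤ scaleLattice (ϖ ^ d₀) w.1 ∧ (w.1.map ((Matrix.toLin' (((γ : GL (Fin 3) K) : Matrix (Fin 3) (Fin 3) K) - 1)).restrictScalars 𝒪[K]) ≤ scaleLattice (ϖ ^ (d₀ - 1)) w.1 ∧ ¬ w.1.map ((Matrix.toLin' (((γ : GL (Fin 3) K) : Matrix (Fin 3) (Fin 3) K) - 1)).restrictScalars 𝒪[K]) ≤ scaleLattice (ϖ ^ d₀) w.1) ∧ ¬ w.1.map ((Matrix.toLin' ((((γ : GL (Fin 3) K) : Matrix (Fin 3) (Fin 3) K) - 1) ^ 2)).restrictScalars 𝒪[K]) ≤ scaleLattice (ϖ ^ (2 * d₀ - 1)) w.1)}).ncard = PO)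
    (hPP : ∑ v ∈ sR, ({w | w ∈ {w | ∃ c, ((latticeGraph σ ϖ ((StdForm.antidiagonal 3).over K)).Adj v c ∧ (latticeGraph σ ϖ ((StdForm.antidiagonal 3).over K)).dist ⟨stdLattice K 3, 0, isSelfDualLattice_stdLattice_three_of_v hϖ⟩ c = (latticeGraph σ ϖ ((StdForm.antidiagonal 3).over K)).dist ⟨stdLattice K 3, 0, isSelfDualLattice_stdLattice_three_of_v hϖ⟩ v + 1 ∧ latticeGraphIso σ ϖ ((StdForm.antidiagonal 3).over K) γ c = c) ∧ ((latticeGraph σ ϖ ((StdForm.antidiagonal 3).over K)).Adj c w ∧ (latticeGraph σ ϖ ((StdForm.antidiagonal 3).over K)).dist ⟨stdLattice K 3, 0, isSelfDualLattice_stdLattice_three_of_v hϖ⟩ w = (latticeGraph σ ϖ ((StdForm.antidiagonal 3).over K)).dist ⟨stdLattice K 3, 0, isSelfDualLattice_stdLattice_three_of_v hϖ⟩ c + 1 ∧ latticeGraphIso σ ϖ ((StdForm.antidiagonal 3).over K) γ w = w)} ∧ (¬ w.1.map ((Matrix.toLin' (((γ : GL (Fin 3) K) : Matrix (Fin 3)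 (Fin 3) K) - 1)).restrictScalars 𝒪[K]) ≤ scaleLattice (ϖ ^ d₀) w.1 ∧ (w.1.map ((Matrix.toLin' (((γ : GL (Fin 3) K) : Matrix (Fin 3) (Fin 3) K) - 1)).restrictScalars 𝒪[K]) ≤ scaleLattice (ϖ ^ (d₀ - 1)) w.1 ∧ ¬ w.1.map ((Matrix.toLin' (((γ : GL (Fin 3) K) : Matrix (Fin 3) (Fin 3) K) - 1)).restrictScalars 𝒪[K]) ≤ scaleLattice (ϖ ^ d₀) w.1) ∧ w.1.map ((Matrix.toLin' ((((γ : GL (Fin 3) K) : Matrix (Fin 3) (Fin 3) K) - 1) ^ 2)).restrictScalars 𝒪[K]) ≤ scaleLattice (ϖ ^ (2 * d₀ - 1)) w.1 ∧ ∃ y ∈ w.1, ∃ a : K, Valued.v a = 1 ∧ Valued.v ((ϖ ^ (d₀ - 1))⁻¹ * pairing σ ((StdForm.antidiagonal 3).over K) y ((((γ : GL (Fin 3) K) : Matrix (Fin 3) (Fin 3) K) - 1) *ᵥ y) - (c₁) * a ^ 2) < 1)}).ncard = PP)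
    (hPM : ∑ v ∈ sR, ({w | w ∈ {w | ∃ c, ((latticeGraph σ ϖ ((StdForm.antidiagonal 3).over K)).Adj v c ∧ (latticeGraph σ ϖ ((StdForm.antidiagonal 3).over K)).dist ⟨stdLattice K 3, 0, isSelfDualLattice_stdLattice_three_of_v hϖ⟩ c = (latticeGraph σ ϖ ((StdForm.antidiagonal 3).over K)).dist ⟨stdLattice K 3, 0, isSelfDualLattice_stdLattice_three_of_v hϖ⟩ v + 1 ∧ latticeGraphIso σ ϖ ((StdForm.antidiagonal 3).over K) γ c = c) ∧ ((latticeGraph σ ϖ ((StdForm.antidiagonal 3).over K)).Adj c w ∧ (latticeGraph σ ϖ ((StdForm.antidiagonal 3).over K)).dist ⟨stdLattice K 3, 0, isSelfDualLattice_stdLattice_three_of_v hϖ⟩ w = (latticeGraph σ ϖ ((StdForm.antidiagonal 3).over K)).dist ⟨stdLattice K 3, 0, isSelfDualLattice_stdLattice_three_of_v hϖ⟩ c + 1 ∧ latticeGraphIso σ ϖ ((StdForm.antidiagonal 3).over K) γ w = w)} ∧ (¬ w.1.map ((Matrix.toLin' (((γ : GL (Fin 3) K) : Matrix (Fin 3)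 (Fin 3) K) - 1)).restrictScalars 𝒪[K]) ≤ scaleLattice (ϖ ^ d₀) w.1 ∧ (w.1.map ((Matrix.toLin' (((γ : GL (Fin 3) K) : Matrix (Fin 3) (Fin 3) K) - 1)).restrictScalars 𝒪[K]) ≤ scaleLattice (ϖ ^ (d₀ - 1)) w.1 ∧ ¬ w.1.map ((Matrix.toLin' (((γ : GL (Fin 3) K) : Matrix (Fin 3) (Fin 3) K) - 1)).restrictScalars 𝒪[K]) ≤ scaleLattice (ϖ ^ d₀) w.1) ∧ w.1.map ((Matrix.toLin' ((((γ : GL (Fin 3) K) : Matrix (Fin 3) (Fin 3) K) - 1) ^ 2)).restrictScalars 𝒪[K]) ≤ scaleLattice (ϖ ^ (2 * d₀ - 1)) w.1 ∧ ¬ (∃ y ∈ w.1, ∃ a : K, Valued.v a = 1 ∧ Valued.v ((ϖ ^ (d₀ - 1))⁻¹ * pairing σ ((StdForm.antidiagonal 3).over K) y ((((γ : GL (Fin 3) K) : Matrix (Fin 3) (Fin 3) K) - 1) *ᵥ y) - (c₁) * a ^ 2) < 1))}).ncard = PM) (j : Fin 5) :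
    ({M : Submodule 𝒪[K] (Fin 3 → K) | IsSelfDualLattice σ ϖ ((StdForm.antidiagonal 3).over K) M ∧ mapGL (γ : GL (Fin 3) K) M = M ∧
        (![¬ M.map ((Matrix.toLin' (((γ : GL (Fin 3) K) : Matrix (Fin 3) (Fin 3) K) - 1)).restrictScalars 𝒪[K]) ≤ scaleLattice ϖ M,
                  M.map ((Matrix.toLin' (((γ : GL (Fin 3) K) : Matrix (Fin 3) (Fin 3) K) - 1)).restrictScalars 𝒪[K]) ≤ scaleLattice ϖ M ∧
                    ¬ M.map ((Matrix.toLin' (((γ : GL (Fin 3) K) : Matrix (Fin 3) (Fin 3) K) - 1)).restrictScalars 𝒪[K]) ≤ scaleLattice (ϖ ^ 2) M ∧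
                    ¬ M.map ((Matrix.toLin' ((((γ : GL (Fin 3) K) : Matrix (Fin 3) (Fin 3) K) - 1) ^ 2)).restrictScalars 𝒪[K]) ≤ scaleLattice (ϖ ^ 3) M,
                  M.map ((Matrix.toLin' (((γ : GL (Fin 3) K) : Matrix (Fin 3) (Fin 3) K) - 1)).restrictScalars 𝒪[K]) ≤ scaleLattice ϖ M ∧
                    ¬ M.map ((Matrix.toLin' (((γ : GL (Fin 3) K) : Matrix (Fin 3) (Fin 3) K) - 1)).restrictScalars 𝒪[K]) ≤ scaleLattice (ϖ ^ 2) M ∧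
                    M.map ((Matrix.toLin' ((((γ : GL (Fin 3) K) : Matrix (Fin 3) (Fin 3) K) - 1) ^ 2)).restrictScalars 𝒪[K]) ≤ scaleLattice (ϖ ^ 3) M ∧
                    ∃ y ∈ M, ∃ a : K, Valued.v a = 1 ∧
                      Valued.v (ϖ⁻¹ * pairing σ (((StdForm.antidiagonal 3).over K)) y
                        ((((γ : GL (Fin 3) K) : Matrix (Fin 3) (Fin 3) K) - 1) *ᵥ y) - c₁ * a ^ 2) < 1,
                  M.map ((Matrix.toLin' (((γ : GL (Fin 3) K) : Matrix (Fin 3) (Fin 3) K) - 1)).restrictScalars 𝒪[K]) ≤ scaleLattice ϖ M ∧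
                    ¬ M.map ((Matrix.toLin' (((γ : GL (Fin 3) K) : Matrix (Fin 3) (Fin 3) K) - 1)).restrictScalars 𝒪[K]) ≤ scaleLattice (ϖ ^ 2) M ∧
                    M.map ((Matrix.toLin' ((((γ : GL (Fin 3) K) : Matrix (Fin 3) (Fin 3) K) - 1) ^ 2)).restrictScalars 𝒪[K]) ≤ scaleLattice (ϖ ^ 3) M ∧
                    ∃ y ∈ M, ∃ a : K, Valued.v a = 1 ∧
                      Valued.v (ϖ⁻¹ * pairing σ (((StdForm.antidiagonal 3).over K)) y
                        ((((γ : GL (Fin 3) K) : Matrix (Fin 3) (Fin 3) K) - 1) *ᵥ y) - c₁ * ε * a ^ 2) < 1,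
                  M.map ((Matrix.toLin' (((γ : GL (Fin 3) K) : Matrix (Fin 3) (Fin 3) K) - 1)).restrictScalars 𝒪[K]) ≤ scaleLattice (ϖ ^ 2) M] : Fin 5 → Prop) j}.ncard) =
      (if IsSquare (-1 : 𝓀[K]) then
          (sR.card • (![0, 0, 0, 0, 1] : Fin 5 → ℕ) + PE • (if mA = 0 then (![1, 0, 0, 0, 0] : Fin 5 → ℕ) else (![q ^ (3 * (mA - 1) + 3), q ^ (3 * (mA - 1) + 2), q.choose 2 * q ^ (2 * (mA - 1)) * ∑ i ∈ Finset.range (mA - 1), q ^ i, q.choose 2 * q ^ (2 * (mA - 1)) * ∑ i ∈ Finset.range (mA - 1), q ^ i,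
          ∑ i ∈ Finset.range (mA - 1 + 1), q ^ (2 * i) + ∑ i ∈ Finset.range (mA - 1), q ^ (2 * (mA - 1) + 1 + i)] : Fin 5 → ℕ)) + PO • (![q ^ (3 * mA + 1), q ^ (3 * mA), q.choose 2 * q ^ (2 * mA - 2) * ∑ i ∈ Finset.range mA, q ^ i, q.choose 2 * q ^ (2 * mA - 2) * ∑ i ∈ Finset.range mA, q ^ i,
          ∑ i ∈ Finset.range mA, q ^ (2 * i) + ∑ i ∈ Finset.range mA, q ^ (2 * mA - 1 + i)] : Fin 5 → ℕ) + PP • (![0, 0, q ^ (2 * mA), 0, ∑ i ∈ Finset.range mA, q ^ (2 * i)] : Fin 5 → ℕ) + PM • (![0, 0, 0, q ^ (2 * mA), ∑ i ∈ Finset.range mA, q ^ (2 * i)] : Fin 5 → ℕ)) j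
        else
          (sR.card • (![0, 0, 0, 0, 1] : Fin 5 → ℕ) + PE • (if mA = 0 then (![1, 0, 0, 0, 0] : Fin 5 → ℕ) else (![q ^ (3 * (mA - 1) + 3), q ^ (3 * (mA - 1) + 2), q.choose 2 * q ^ (2 * (mA - 1)) * ∑ i ∈ Finset.range (mA - 1), q ^ i, q.choose 2 * q ^ (2 * (mA - 1)) * ∑ i ∈ Finset.range (mA - 1), q ^ i,
          ∑ i ∈ Finset.range (mA - 1 + 1), q ^ (2 * i) + ∑ i ∈ Finset.range (mA - 1), q ^ (2 * (mA - 1) + 1 + i)] : Fin 5 → ℕ)) + PO • (![q ^ (3 * mA + 1), q ^ (3 * mA), q.choose 2 * q ^ (2 * mA - 2) * ∑ i ∈ Finset.range mA, q ^ i, q.choose 2 * q ^ (2 * mA - 2) * ∑ i ∈ Finset.range mA, q ^ i,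
          ∑ i ∈ Finset.range mA, q ^ (2 * i) + ∑ i ∈ Finset.range mA, q ^ (2 * mA - 1 + i)] : Fin 5 → ℕ) + PP • (![0, 0, if Even mA then q ^ (2 * mA) else 0, if Even mA then 0 else q ^ (2 * mA), ∑ i ∈ Finset.range mA, q ^ (2 * i)] : Fin 5 → ℕ) + PM • (![0, 0, if Even mA then 0 else q ^ (2 * mA), if Even mA then q ^ (2 * mA) else 0, ∑ i ∈ Finset.range mA, q ^ (2 * i)] : Fin 5 → ℕ)) j) := by
  obtain ⟨γv, hγU⟩ := γ
  change γv = _ at hγ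
  subst hγ
  have hϖ0 : ϖ ≠ 0 := fun h0 => by rw [h0, map_zero] at hϖ; exact WithZero.coe_ne_zero hϖ.symm
  have hϖ1 : Valued.v ϖ < 1 := by rw [hϖ, ← WithZero.exp_zero]; exact WithZero.exp_lt_exp.2 (by norm_num)
  have hd1 : 1 ≤ d₀ := by omega
  have hBint : IsIntMatrix (B₀ : Matrix (Fin 2) (Fin 2) K) := fun i j => by
    have hϖd : Valued.v ϖ ^ d₀ ≤ 1 := pow_le_one₀ zero_le hϖ1.le
    have h1 : Valued.v ((1 : Matrix (Fin 2) (Fin 2) K) i j) ≤ 1 := by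
      rcases eq_or_ne i j with rfl | hij
      · rw [Matrix.one_apply_eq, map_one]
      · rw [Matrix.one_apply_ne hij, map_zero]; exact zero_le
    have h := Valuation.map_add_le (Valued.v) ((hd i j).trans hϖd) h1
    rwa [Matrix.sub_apply, sub_add_cancel] at h
  exact strataCount_J₀_of_charpoly_block_even hσ hvσ hσϖ hϖ hres h2 hnorm (endoGL_one_mem_unitaryInt hϖ1 hγU hd1 hd) 1 (B₀ : Matrix (Fin 2) (Fin 2) K)
    (charpoly_coe_endoGL_one B₀) (by rw [sub_self, map_zero]; exact zero_le) hd (map_sub_one_stdLattice_le_scaleLattice_endoGL_one hϖ0 hd)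
    (finite_setOf_latticeGraphIso_endoGL_one_antidiagonal hvσ h2 hsq hϖ B₀ hBint hirr _ rfl)
    mA hmA c₁ ε hc₁ hεv hε q hq sR hsR PE PO PP PM hPE hPO hPP hPM j

end Literature.NumberTheory.Rogawski1990.TypeOneRamifiedJunction

end
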